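import Mathlib.Data.Finset.Card
import Mathlib.Data.Finset.Image
import Mathlib.Data.List.Basic
import Mathlib.Data.Fintype.Basic
import Mathlib.Data.Fintype.Prod
import Mathlib.Data.Fin.Basic
import Mathlib.Algebra.BigOperators.Group.Finset.Basic
import Mathlib.Algebra.Order.BigOperators.Group.Finset
import HarnessLib

/-!
# Scanning a chain: distinct vertices versus distinct edges
(the two counting claims of Allen–O'Donnell–Witmer 2015, App. A.4, for the odd matrix)

Trunk T-CPLX-CORE (Literature/Computability/Complexity). Support file for the discharge of the
named fact `allen_odonnell_witmer_kSAT` (`AOWRefutation.lean`), probabilistic part V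
(pure combinatorics for AOW's Lemma A.2).

In the trace expansion of `tr((AᵀA)^m)` for AOW's matrix `A` (eq. (A-def)), a term is indexed by
row pairs `P_t = (i_t, i'_t)`, column pairs `Q_t = (j_t, j'_t)` (`t ∈ ℤ/m`), last coordinates
`ℓ_{t,s}` (slots `s ∈ {0,1}`: the entries `A(P_t, Q_t)` and `A(P_t, Q_{t+1})`), and for each of the
`4m` half-slots a "triple" `(block of P, block of Q, ℓ)`. AOW's Claims 6–7 compare the number
`u` of DISTINCT triples with the number `b` of distinct `ℓ`'s and the number `a` of distinct
blocks: `u ≥ 2b` (the two triples of a slot are distinct because the `(i,j) = (i',j')` entries of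
`A` are zero) and `a ≤ u + O(1)` (the blocks are visited along two closed walks whose edges are
the triples). We prove both in the abstract:

* `IsChain comp x L` — a walk `x = x₀, (τ₁, x₁), (τ₂, x₂), …` whose edge labels `τ_i` determine
  their endpoints (`x_i ∈ comp τ_i ⊆ {x_{i-1}, x_i}`), and the **scan lemma**
  `IsChain.card_verts_sdiff_le`: `|vertices \ S₀| ≤ |labels \ T₀|` whenever `x₀ ∈ S₀` and the
  endpoints of the labels in `T₀` lie in `S₀` (a new vertex is entered through a new label);
* the two chains `chainSteps` of a configuration `(P, Q, ℓ)` and the consequences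
  `card_blockSet_le` (`a ≤ u + 3`) and `two_mul_card_image_lst_le` (`2b ≤ u`, under the
  off-diagonal condition).

## References

* S. R. Allen, R. O'Donnell, D. Witmer, *How to refute a random CSP*, FOCS 2015,
  arXiv:1505.04383, App. A.4, Claims 6 and 7 in the proof of Lemma A.2.
-/

namespace Literature.Computability.Complexity

open Finset

/-! ### Chains and the scan lemma -/

section Scan

variable {I Tr : Type} [DecidableEq I] [DecidableEq Tr]

/-- A **chain** from the vertex `x`: a list of steps `(τ, y)` — an edge label and the vertex it
leads to — such that each label determines the endpoints of its edge: `y ∈ comp τ ⊆ {x, y}`.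
[Allen–O'Donnell–Witmer 2015, App. A.4 (the factors `w_{i,j,ℓ}` along the index pattern of
`P_{J,L}`)] [folklore] -/
inductive IsChain (comp : Tr → Finset I) : I → List (Tr × I) → Prop
  | nil (x : I) : IsChain comp x []
  | cons {x y : I} {τ : Tr} {rest : List (Tr × I)} :
      y ∈ comp τ → comp τ ⊆ {x, y} → IsChain comp y rest → IsChain comp x ((τ, y) :: rest)

/-- The vertices entered by a list of steps. [folklore] -/
def stepVerts (L : List (Tr × I)) : Finset I := (L.map Prod.snd).toFinset

/-- The edge labels of a list of steps. [folklore] -/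
def stepLabels (L : List (Tr × I)) : Finset Tr := (L.map Prod.fst).toFinset

omit [DecidableEq Tr] in
/-- `stepVerts` of a cons. [folklore] -/
@[simp] theorem stepVerts_cons (τ : Tr) (y : I) (L : List (Tr × I)) :
    stepVerts ((τ, y) :: L) = insert y (stepVerts L) := by
  simp [stepVerts]

omit [DecidableEq I] in
/-- `stepLabels` of a cons. [folklore] -/
@[simp] theorem stepLabels_cons (τ : Tr) (y : I) (L : List (Tr × I)) :
    stepLabels ((τ, y) :: L) = insert τ (stepLabels L) := by
  simp [stepLabels]

omit [DecidableEq Tr] in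
/-- `stepVerts [] = ∅`. [folklore] -/
@[simp] theorem stepVerts_nil : stepVerts ([] : List (Tr × I)) = ∅ := rfl

omit [DecidableEq I] in
/-- `stepLabels [] = ∅`. [folklore] -/
@[simp] theorem stepLabels_nil : stepLabels ([] : List (Tr × I)) = ∅ := rfl

/-- Along a chain, the endpoints of every edge label are among the start vertex and the entered
vertices. [folklore] -/
theorem IsChain.comp_subset {comp : Tr → Finset I} {x : I} {L : List (Tr × I)}
    (h : IsChain comp x L) : ∀ τ ∈ stepLabels L, comp τ ⊆ insert x (stepVerts L) := by
  induction h with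
  | nil x => simp
  | @cons x y τ rest hy hτ hrest ih =>
    intro τ' hτ'
    rw [stepLabels_cons, Finset.mem_insert] at hτ'
    rw [stepVerts_cons]
    rcases hτ' with rfl | hτ'
    · intro z hz
      have := hτ hz
      simp only [Finset.mem_insert, Finset.mem_singleton] at this
      rcases this with rfl | rfl <;> simp
    · intro z hz
      have := ih τ' hτ' hz
      simp only [Finset.mem_insert] at this ⊢
      tauto

/-- **The scan lemma**: along a chain starting in `S₀`, the number of entered vertices outside `S₀`
is at most the number of edge labels outside `T₀`, provided the endpoints of the labels of `T₀` lie
in `S₀` — a vertex outside `S₀` is first entered through a label that is new and not in `T₀`.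
[Allen–O'Donnell–Witmer 2015, App. A.4, proof of Claim 7 ("each subsequent pair shares two
variables with its preceding pair")] [cite: arXiv150504383, App. A] -/
theorem IsChain.card_verts_sdiff_le {comp : Tr → Finset I} {x : I} {L : List (Tr × I)}
    (h : IsChain comp x L) :
    ∀ (S₀ : Finset I) (T₀ : Finset Tr), x ∈ S₀ → (∀ τ ∈ T₀, comp τ ⊆ S₀) →
      (stepVerts L \ S₀).card ≤ (stepLabels L \ T₀).card := by
  induction h with
  | nil x => intro S₀ T₀ _ _; simp
  | @cons x y τ rest hy hτ hrest ih =>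
    intro S₀ T₀ hx hT
    -- scan the rest from `y`, with `y` and `τ` now old
    have ih' := ih (insert y S₀) (insert τ T₀) (Finset.mem_insert_self _ _) (by
      intro τ' hτ'
      rw [Finset.mem_insert] at hτ'
      rcases hτ' with rfl | hτ'
      · intro z hz
        have := hτ hz
        simp only [Finset.mem_insert, Finset.mem_singleton] at this ⊢
        rcases this with rfl | rfl
        · exact Or.inr hx
        · exact Or.inl rfl
      · exact (hT τ' hτ').trans (Finset.subset_insert _ _))
    -- if `τ` is old then so is `y`
    have hyτ : (if y ∈ S₀ then 0 else 1) ≤ (if τ ∈ T₀ then 0 else 1) := by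
      by_cases hτ0 : τ ∈ T₀
      · rw [if_pos (hT τ hτ0 hy), if_pos hτ0]
      · rw [if_neg hτ0]
        split_ifs <;> omega
    rw [stepVerts_cons, stepLabels_cons]
    calc ((insert y (stepVerts rest)) \ S₀).card
        ≤ (({y} : Finset I) \ S₀).card + (stepVerts rest \ insert y S₀).card := by
          refine (Finset.card_le_card ?_).trans (Finset.card_union_le _ _)
          intro z hz
          simp only [Finset.mem_sdiff, Finset.mem_insert, Finset.mem_union, Finset.mem_singleton]
            at hz ⊢
          tauto
      _ ≤ (if y ∈ S₀ then 0 else 1) + (stepLabels rest \ insert τ T₀).card := by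
          apply add_le_add _ ih'
          split_ifs with hyS
          · rw [Finset.sdiff_eq_empty_iff_subset.2 (Finset.singleton_subset_iff.2 hyS),
              Finset.card_empty]
          · rw [Finset.sdiff_eq_self_of_disjoint (Finset.disjoint_singleton_left.2 hyS),
              Finset.card_singleton]
      _ ≤ (if τ ∈ T₀ then 0 else 1) + (stepLabels rest \ insert τ T₀).card :=
          add_le_add hyτ le_rfl
      _ = ((({τ} : Finset Tr) \ T₀) ∪ (stepLabels rest \ insert τ T₀)).card := by
          rw [Finset.card_union_of_disjoint]
          · congr 1
            split_ifs with hτT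
            · rw [Finset.sdiff_eq_empty_iff_subset.2 (Finset.singleton_subset_iff.2 hτT),
                Finset.card_empty]
            · rw [Finset.sdiff_eq_self_of_disjoint (Finset.disjoint_singleton_left.2 hτT),
                Finset.card_singleton]
          · rw [Finset.disjoint_left]
            intro z hz hz'
            simp only [Finset.mem_sdiff, Finset.mem_singleton, Finset.mem_insert] at hz hz'
            exact hz'.2 (Or.inl hz.1)
      _ ≤ ((insert τ (stepLabels rest)) \ T₀).card := by
          refine Finset.card_le_card ?_
          intro z hz
          simp only [Finset.mem_union, Finset.mem_sdiff, Finset.mem_singleton, Finset.mem_insert]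
            at hz ⊢
          tauto

/-- Scan from the start vertex alone: `|vertices| ≤ |labels| + 1`. [Allen–O'Donnell–Witmer
2015, App. A.4, Claim 7] [folklore] -/
theorem IsChain.card_verts_le {comp : Tr → Finset I} {x : I} {L : List (Tr × I)}
    (h : IsChain comp x L) : (insert x (stepVerts L)).card ≤ (stepLabels L).card + 1 := by
  have h1 := h.card_verts_sdiff_le {x} ∅ (Finset.mem_singleton_self x) (by simp)
  rw [Finset.sdiff_empty] at h1
  calc (insert x (stepVerts L)).card
      ≤ ((insert x (stepVerts L)) \ {x}).card + ({x} : Finset I).card :=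
        Finset.card_le_card_sdiff_add_card
    _ = (stepVerts L \ {x}).card + 1 := by
        rw [Finset.insert_sdiff_of_mem _ (Finset.mem_singleton_self x), Finset.card_singleton]
    _ ≤ (stepLabels L).card + 1 := by omega

end Scan

/-! ### The two chains of a configuration of AOW's odd matrix -/

section Config

variable {I K : Type} [DecidableEq I] [DecidableEq K] {n : ℕ}

/-- The `h`-th block of a pair (`h = 0`: first, `h = 1`: second). [folklore] -/
def blockOf (h : Fin 2) (x : I × I) : I := if h = 0 then x.1 else x.2

/-- The column pair of the slot `(t, s)`: `Q_t` for the entry `A(P_t, Q_t)` (`s = 0`) and `Q_{t+1}`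
for the entry `A(P_t, Q_{t+1})` (`s = 1`). [Allen–O'Donnell–Witmer 2015, App. A.4] [folklore] -/
def colPair (Q : Fin (n + 1) → I × I) (t : Fin (n + 1)) (s : Fin 2) : I × I :=
  if s = 0 then Q t else Q (t + 1)

/-- The **triple** of the half-slot `(t, s, h)`: (`h`-block of `P_t`, `h`-block of the column pair,
last coordinate `ℓ_{t,s}`) — the index of the factor `w_{i,j,ℓ}` of AOW's expansion.
[Allen–O'Donnell–Witmer 2015, App. A.4 (the factors of `P_{J,L}`)] [cite: arXiv150504383, App. A] -/
def tripleAt (P Q : Fin (n + 1) → I × I) (ℓ : Fin (n + 1) × Fin 2 → K) (t : Fin (n + 1))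
    (s h : Fin 2) : I × I × K :=
  (blockOf h (P t), blockOf h (colPair Q t s), ℓ (t, s))

/-- The set of triples of a configuration (its cardinality is AOW's number of distinct
`w`-factors). [Allen–O'Donnell–Witmer 2015, App. A.4] [cite: arXiv150504383, App. A] -/
def tripleSet [Fintype I] [Fintype K] (P Q : Fin (n + 1) → I × I) (ℓ : Fin (n + 1) × Fin 2 → K) :
    Finset (I × I × K) :=
  univ.image fun x : Fin (n + 1) × Fin 2 × Fin 2 => tripleAt P Q ℓ x.1 x.2.1 x.2.2

/-- The set of blocks of a configuration (AOW's `J`). [Allen–O'Donnell–Witmer 2015, App. A.4] [cite: arXiv150504383, App. A] -/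
def blockSet [Fintype I] (P Q : Fin (n + 1) → I × I) : Finset I :=
  (univ.image fun x : Fin (n + 1) × Fin 2 => blockOf x.2 (P x.1)) ∪
    univ.image fun x : Fin (n + 1) × Fin 2 => blockOf x.2 (Q x.1)

/-- The endpoints (blocks) of a triple. [folklore] -/
def tripleComp (τ : I × I × K) : Finset I := {τ.1, τ.2.1}

/-- Cyclic index. [folklore] -/
def cyc (n t : ℕ) : Fin (n + 1) := ⟨t % (n + 1), Nat.mod_lt _ n.succ_pos⟩

/-- `t + 1 = cyc (t+1)` in `Fin (n+1)`. [folklore] -/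
theorem add_one_eq_cyc (t : Fin (n + 1)) : t + 1 = cyc n (t.val + 1) := by
  apply Fin.ext
  simp [cyc, Fin.val_add]

/-- `cyc t = t` for `t < n+1`. [folklore] -/
theorem cyc_of_lt {t : ℕ} (h : t < n + 1) : cyc n t = ⟨t, h⟩ := by
  apply Fin.ext
  simp [cyc, Nat.mod_eq_of_lt h]

/-- The steps of the `h`-chain from slot `t₀` for `c` further values of `t`: per `t`, the edge
`Q_t.h → P_t.h` labelled by the triple of `(t, 0, h)` and the edge `P_t.h → Q_{t+1}.h` labelled by
the triple of `(t, 1, h)`. [Allen–O'Donnell–Witmer 2015, App. A.4 (the index pattern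
`w_{i₁j₁ℓ₁} w_{i₂j₂ℓ₁} w_{i₃j₁ℓ₂} …`)] [cite: arXiv150504383, App. A] -/
def chainSteps (P Q : Fin (n + 1) → I × I) (ℓ : Fin (n + 1) × Fin 2 → K) (h : Fin 2) :
    ℕ → ℕ → List ((I × I × K) × I)
  | _, 0 => []
  | t₀, c + 1 =>
    (tripleAt P Q ℓ (cyc n t₀) 0 h, blockOf h (P (cyc n t₀))) ::
      (tripleAt P Q ℓ (cyc n t₀) 1 h, blockOf h (Q (cyc n (t₀ + 1)))) ::
        chainSteps P Q ℓ h (t₀ + 1) c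

omit [DecidableEq K] in
/-- The `h`-chain is a chain from `Q_{t₀}.h`. [Allen–O'Donnell–Witmer 2015, App. A.4] [folklore] -/
theorem isChain_chainSteps (P Q : Fin (n + 1) → I × I) (ℓ : Fin (n + 1) × Fin 2 → K) (h : Fin 2) :
    ∀ c t₀ : ℕ, IsChain tripleComp (blockOf h (Q (cyc n t₀))) (chainSteps P Q ℓ h t₀ c) := by
  intro c
  induction c with
  | zero => intro t₀; exact IsChain.nil _
  | succ c ih =>
    intro t₀
    have hQ1 : colPair Q (cyc n t₀) 1 = Q (cyc n (t₀ + 1)) := by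
      rw [colPair, if_neg (by decide), add_one_eq_cyc]
      apply congrArg
      apply Fin.ext
      simp only [cyc]
      rw [Nat.add_mod, Nat.mod_mod, ← Nat.add_mod]
    refine IsChain.cons ?_ ?_ (IsChain.cons ?_ ?_ (ih (t₀ + 1)))
    · simp [tripleComp, tripleAt]
    · intro z hz
      simp only [tripleComp, tripleAt, colPair, Fin.isValue, if_true, Finset.mem_insert,
        Finset.mem_singleton] at hz ⊢
      tauto
    · simp [tripleComp, tripleAt, hQ1]
    · intro z hz
      simp only [tripleComp, tripleAt, hQ1, Finset.mem_insert, Finset.mem_singleton] at hz ⊢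
      tauto

/-- The labels of the `h`-chain are triples of the configuration. [folklore] -/
theorem stepLabels_chainSteps_subset [Fintype I] [Fintype K] (P Q : Fin (n + 1) → I × I)
    (ℓ : Fin (n + 1) × Fin 2 → K) (h : Fin 2) :
    ∀ c t₀ : ℕ, stepLabels (chainSteps P Q ℓ h t₀ c) ⊆ tripleSet P Q ℓ := by
  intro c
  induction c with
  | zero => intro t₀; simp [chainSteps]
  | succ c ih =>
    intro t₀ τ hτ
    simp only [chainSteps, stepLabels_cons, Finset.mem_insert] at hτ
    rcases hτ with rfl | rfl | hτ
    · exact Finset.mem_image.2 ⟨(cyc n t₀, 0, h), Finset.mem_univ _, rfl⟩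
    · exact Finset.mem_image.2 ⟨(cyc n t₀, 1, h), Finset.mem_univ _, rfl⟩
    · exact ih (t₀ + 1) hτ

omit [DecidableEq K] in
/-- The full `h`-chain (all `n+1` values of `t`, from `t₀ = 0`) enters every `h`-block of the
configuration. [folklore] -/
theorem blocks_subset_stepVerts_chainSteps [Fintype I] (P Q : Fin (n + 1) → I × I)
    (ℓ : Fin (n + 1) × Fin 2 → K) (h : Fin 2) (t : Fin (n + 1)) :
    blockOf h (P t) ∈ stepVerts (chainSteps P Q ℓ h 0 (n + 1)) ∧
      blockOf h (Q t) ∈ stepVerts (chainSteps P Q ℓ h 0 (n + 1)) := by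
  -- the chain from `t₀` with `c` rounds enters `P_{t₀+i}.h` and `Q_{t₀+i+1}.h` for `i < c`
  have key : ∀ c t₀ i : ℕ, i < c →
      blockOf h (P (cyc n (t₀ + i))) ∈ stepVerts (chainSteps P Q ℓ h t₀ c) ∧
        blockOf h (Q (cyc n (t₀ + i + 1))) ∈ stepVerts (chainSteps P Q ℓ h t₀ c) := by
    intro c
    induction c with
    | zero => intro t₀ i hi; omega
    | succ c ih =>
      intro t₀ i hi
      simp only [chainSteps, stepVerts_cons, Finset.mem_insert]
      rcases Nat.eq_zero_or_pos i with rfl | hi0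
      · simp
      · obtain ⟨i', rfl⟩ := Nat.exists_eq_add_of_lt hi0
        have := ih (t₀ + 1) i' (by omega)
        rw [show t₀ + (0 + i' + 1) = t₀ + 1 + i' from by omega]
        exact ⟨Or.inr (Or.inr this.1), Or.inr (Or.inr this.2)⟩
  constructor
  · have := (key (n + 1) 0 t.val t.isLt).1
    rwa [zero_add, cyc_of_lt t.isLt] at this
  · -- `Q_t.h` is entered at round `t - 1` (or at round `n` for `t = 0`, by wrap-around)
    rcases Nat.eq_zero_or_pos t.val with ht | ht
    · have := (key (n + 1) 0 n (Nat.lt_succ_self n)).2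
      rw [zero_add] at this
      have hc : cyc n (n + 1) = t := by
        apply Fin.ext
        simp [cyc, ht]
      rwa [hc] at this
    · obtain ⟨i, hi⟩ := Nat.exists_eq_add_of_lt ht
      have hi' : i < n + 1 := by have := t.isLt; omega
      have := (key (n + 1) 0 i hi').2
      have hc : cyc n (0 + i + 1) = t := by
        rw [cyc_of_lt (by omega)]
        apply Fin.ext
        simp only
        omega
      rwa [hc] at this

/-- **Claim 7 (AOW)**: the number of distinct blocks is at most the number of distinct triples
plus three. [Allen–O'Donnell–Witmer 2015, App. A.4, Claim 7 (`#distinct w ≥ |J| - 2`; the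
additive constant is immaterial)] [cite: arXiv150504383, App. A] -/
theorem card_blockSet_le [Fintype I] [Fintype K] (P Q : Fin (n + 1) → I × I)
    (ℓ : Fin (n + 1) × Fin 2 → K) :
    (blockSet P Q).card ≤ (tripleSet P Q ℓ).card + 3 := by
  have h₀ : IsChain tripleComp (blockOf 0 (Q 0)) (chainSteps P Q ℓ 0 0 (n + 1)) := by
    have := isChain_chainSteps P Q ℓ 0 (n + 1) 0
    rwa [cyc_of_lt n.succ_pos] at this
  have h₁ : IsChain tripleComp (blockOf 1 (Q 0)) (chainSteps P Q ℓ 1 0 (n + 1)) := by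
    have := isChain_chainSteps P Q ℓ 1 (n + 1) 0
    rwa [cyc_of_lt n.succ_pos] at this
  -- everything seen by the first chain, plus the start of the second
  let S₀ : Finset I := insert (blockOf (1 : Fin 2) (Q 0))
    (insert (blockOf (0 : Fin 2) (Q 0)) (stepVerts (chainSteps P Q ℓ 0 0 (n + 1))))
  -- all blocks are entered by one of the two chains
  have hblk : ∀ (h : Fin 2) (t : Fin (n + 1)),
      blockOf h (P t) ∈ S₀ ∪ stepVerts (chainSteps P Q ℓ 1 0 (n + 1)) ∧
        blockOf h (Q t) ∈ S₀ ∪ stepVerts (chainSteps P Q ℓ 1 0 (n + 1)) := by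
    rw [Fin.forall_fin_two]
    refine ⟨fun t => ⟨?_, ?_⟩, fun t => ⟨?_, ?_⟩⟩
    · exact Finset.mem_union_left _ (Finset.mem_insert_of_mem (Finset.mem_insert_of_mem
        (blocks_subset_stepVerts_chainSteps P Q ℓ 0 t).1))
    · exact Finset.mem_union_left _ (Finset.mem_insert_of_mem (Finset.mem_insert_of_mem
        (blocks_subset_stepVerts_chainSteps P Q ℓ 0 t).2))
    · exact Finset.mem_union_right _ (blocks_subset_stepVerts_chainSteps P Q ℓ 1 t).1
    · exact Finset.mem_union_right _ (blocks_subset_stepVerts_chainSteps P Q ℓ 1 t).2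
  have hcover : blockSet P Q ⊆ S₀ ∪ (stepVerts (chainSteps P Q ℓ 1 0 (n + 1)) \ S₀) := by
    rw [Finset.union_sdiff_self_eq_union]
    intro z hz
    rw [blockSet, Finset.mem_union, Finset.mem_image, Finset.mem_image] at hz
    rcases hz with ⟨x, -, rfl⟩ | ⟨x, -, rfl⟩
    · exact (hblk x.2 x.1).1
    · exact (hblk x.2 x.1).2
  -- scan the first chain from its start, the second from everything seen so far
  have hscan₀ : (insert (blockOf (0 : Fin 2) (Q 0)) (stepVerts (chainSteps P Q ℓ 0 0 (n + 1)))).card ≤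
      (stepLabels (chainSteps P Q ℓ 0 0 (n + 1))).card + 1 := h₀.card_verts_le
  have hscan₁ : (stepVerts (chainSteps P Q ℓ 1 0 (n + 1)) \ S₀).card ≤
      (stepLabels (chainSteps P Q ℓ 1 0 (n + 1)) \ stepLabels (chainSteps P Q ℓ 0 0 (n + 1))).card := by
    refine h₁.card_verts_sdiff_le S₀ _ (Finset.mem_insert_self _ _) ?_
    intro τ hτ
    exact (h₀.comp_subset τ hτ).trans (Finset.subset_insert _ _)
  have hlabels : (stepLabels (chainSteps P Q ℓ 0 0 (n + 1))).card +
      (stepLabels (chainSteps P Q ℓ 1 0 (n + 1)) \ stepLabels (chainSteps P Q ℓ 0 0 (n + 1))).card ≤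
      (tripleSet P Q ℓ).card := by
    rw [← Finset.card_union_of_disjoint Finset.disjoint_sdiff]
    exact Finset.card_le_card (Finset.union_subset (stepLabels_chainSteps_subset P Q ℓ 0 _ _)
      (Finset.sdiff_subset.trans (stepLabels_chainSteps_subset P Q ℓ 1 _ _)))
  have hS₀ : S₀.card ≤ (stepLabels (chainSteps P Q ℓ 0 0 (n + 1))).card + 1 + 1 :=
    (Finset.card_insert_le _ _).trans (add_le_add hscan₀ le_rfl)
  calc (blockSet P Q).card
      ≤ (S₀ ∪ (stepVerts (chainSteps P Q ℓ 1 0 (n + 1)) \ S₀)).card := Finset.card_le_card hcover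
    _ ≤ S₀.card + (stepVerts (chainSteps P Q ℓ 1 0 (n + 1)) \ S₀).card := Finset.card_union_le _ _
    _ ≤ (tripleSet P Q ℓ).card + 3 := by omega

/-- **Claim 6 (AOW)**: if the two triples of every slot are distinct (the entries of `A` with
`(i,j) = (i',j')` vanish), the number of distinct last coordinates is at most half the number of
distinct triples. [Allen–O'Donnell–Witmer 2015, App. A.4, Claim 6] [cite: arXiv150504383, App. A] -/
theorem two_mul_card_image_lst_le [Fintype I] [Fintype K] (P Q : Fin (n + 1) → I × I)
    (ℓ : Fin (n + 1) × Fin 2 → K)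
    (hoff : ∀ t s, tripleAt P Q ℓ t s 0 ≠ tripleAt P Q ℓ t s 1) :
    2 * (univ.image ℓ).card ≤ (tripleSet P Q ℓ).card := by
  have hfib := Finset.card_eq_sum_card_image (fun τ : I × I × K => τ.2.2) (tripleSet P Q ℓ)
  rw [hfib]
  have hsub : univ.image ℓ ⊆ (tripleSet P Q ℓ).image fun τ : I × I × K => τ.2.2 := by
    intro v hv
    obtain ⟨⟨t, s⟩, -, rfl⟩ := Finset.mem_image.1 hv
    exact Finset.mem_image.2 ⟨tripleAt P Q ℓ t s 0,
      Finset.mem_image.2 ⟨(t, s, 0), Finset.mem_univ _, rfl⟩, rfl⟩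
  calc 2 * (univ.image ℓ).card = ∑ _v ∈ univ.image ℓ, 2 := by
        rw [Finset.sum_const_nat fun _ _ => rfl, mul_comm]
    _ ≤ ∑ v ∈ univ.image ℓ, ((tripleSet P Q ℓ).filter fun τ => τ.2.2 = v).card := by
        refine Finset.sum_le_sum fun v hv => ?_
        obtain ⟨⟨t, s⟩, -, rfl⟩ := Finset.mem_image.1 hv
        rw [Nat.succ_le_iff, Finset.one_lt_card_iff]
        refine ⟨tripleAt P Q ℓ t s 0, tripleAt P Q ℓ t s 1, ?_, ?_, hoff t s⟩
        · exact Finset.mem_filter.2 ⟨Finset.mem_image.2 ⟨(t, s, 0), Finset.mem_univ _, rfl⟩, rfl⟩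
        · exact Finset.mem_filter.2 ⟨Finset.mem_image.2 ⟨(t, s, 1), Finset.mem_univ _, rfl⟩, rfl⟩
    _ ≤ _ := Finset.sum_le_sum_of_subset_of_nonneg hsub fun _ _ _ => Nat.zero_le _

end Config

end Literature.Computability.Complexity
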